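import Literature.Analysis.FluidPDE.NewtonPotentialHolder
import Literature.Analysis.FluidPDE.BiotSavartNewtonKernel
import HarnessLib

/-!
# Representation of a compactly supported `C²` function from its Laplacian in divergence form

Analysis/FluidPDE support file (everything proved) on the discharge path of the named fact
`Literature.Analysis.FluidPDE.LaplaceDivFormInteriorHolder` (`NSBoundedSpatialHolder.lean`;
Gilbarg–Trudinger 2001, Thm. 8.24 for the Laplacian), companion of `NewtonPotentialHolder`
(Hölder estimates for potentials `P f(x) = ∫ f(y) k(x - y) dy` against the singular kernels
`Γ` and `∂ⱼΓ = NewtonPotentialHolder.newtonKernelGrad j`). It combines two identities of the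
tree — Green's representation `∫ Γ(y - x) Δψ(x) dx = ψ(y)` for `ψ ∈ C²_c`
(`integral_newtonKernel_mul_laplacian`, `BiotSavartNewtonKernel`) and the integration by parts
against the `W^{1,1}_loc` kernel `Γ`, `∫ Γ(y - x) ∂ₐΦ(x) dx = ∫ ∂ₐΓ(y - x) Φ(x) dx` for
`Φ ∈ C¹_c` (`integral_newtonKernel_smul_fderiv_eq`, ibid.) — into the statement consumed by the
discharge:

* `newtonKernelGrad_eq_fderiv_newtonKernel`: `newtonKernelGrad j z = DΓ(z) eⱼ` for **all** `z`
  (off the origin by `NewtonPotentialHolder.newtonKernelGrad_eq_fderiv`; at the origin both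
  sides are the junk value `0`, `fderiv_newtonKernel_zero`);
* `locallyIntegrable_newtonKernel`: `Γ ∈ L¹_loc(ℝ³)`;
* `eq_sum_potential_of_laplacian_eq`: **if `W ∈ C²_c(ℝ³)` and `ΔW = ∑ⱼ ∂ⱼGⱼ + H` pointwise with
  `Gⱼ ∈ C¹_c`, `H ∈ C_c`, then `W(x) = ∑ⱼ ∫ Gⱼ(y) ∂ⱼΓ(x - y) dy + ∫ H(y) Γ(x - y) dy`**, the
  potentials being exactly those estimated by `NewtonPotentialHolder.abs_potential_le` /
  `abs_potential_sub_le`.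

In the planned discharge this is applied to the mollifications `W = ρ ⋆ (χw)` of the localised
weak solution, whose Laplacian is `∑ⱼ ∂ⱼ(ρ ⋆ f'ⱼ) + ρ ⋆ h'` pointwise
(`LaplaceDivFormLocalisation`).

## Mathlib / tree search

Tree (all used): `integral_newtonKernel_mul_laplacian`, `integral_newtonKernel_smul_fderiv_eq`,
`fderiv_newtonKernel_zero` (`BiotSavartNewtonKernel`), `integrable_newtonKernel_mul`
(`NormalisedPressureL2Bound`), `newtonKernelGrad`, `newtonKernelGrad_eq_fderiv`
(`NewtonPotentialHolder`), `abs_newtonKernel`, `measurable_newtonKernel` (`NewtonKernel`,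
`NewtonPotential`). Mathlib: `locallyIntegrable_of_norm_le_rpow`.

## References

* D. Gilbarg, N. S. Trudinger, *Elliptic Partial Differential Equations of Second Order*
  (2001), (2.17) (Green's representation formula) and Lemma 4.1 (derivatives of the Newtonian
  potential). [`GilbargTrudinger2001`]
-/

noncomputable section

open MeasureTheory Set Function Filter Topology TopologicalSpace Metric Real
open scoped NNReal ENNReal RealInnerProductSpace Laplacian

namespace Literature.Analysis.FluidPDE

namespace NewtonPotentialRepresentation

open NewtonPotentialHolder (newtonKernelGrad newtonKernelGrad_eq_fderiv)

/-- **`∂ⱼΓ = DΓ eⱼ` everywhere**: the everywhere-defined kernel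
`newtonKernelGrad j z = zⱼ/(4π|z|³)` agrees with `fderiv ℝ newtonKernel z eⱼ` for every `z`
(at `z = 0` both are the junk value `0`). [folklore] -/
theorem newtonKernelGrad_eq_fderiv_newtonKernel (j : Fin 3) (z : EuclideanSpace ℝ (Fin 3)) :
    newtonKernelGrad j z = fderiv ℝ newtonKernel z (EuclideanSpace.single j (1 : ℝ)) := by
  by_cases hz : z = 0
  · subst hz
    rw [fderiv_newtonKernel_zero]
    simp [newtonKernelGrad]
  · exact newtonKernelGrad_eq_fderiv hz

/-- `Γ` is locally integrable on `ℝ³` (`|Γ(z)| = (4π)⁻¹|z|⁻¹` and `1 < 3`). [folklore] -/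
theorem locallyIntegrable_newtonKernel :
    LocallyIntegrable newtonKernel (volume : Measure (EuclideanSpace ℝ (Fin 3))) := by
  refine locallyIntegrable_of_norm_le_rpow (by rw [finrank_euclideanSpace_fin]; norm_num)
    (C := (4 * π)⁻¹) (α := 1) (by rw [finrank_euclideanSpace_fin]; norm_num)
    (Eventually.of_forall fun z => ?_) measurable_newtonKernel.aestronglyMeasurable
  rw [Real.norm_eq_abs, abs_newtonKernel, Real.rpow_neg_one, mul_inv]

/-- **Representation of a compactly supported `C²` function from its Laplacian in divergence
form.** If `W ∈ C²_c(ℝ³)` and `ΔW = ∑ⱼ ∂ⱼGⱼ + H` pointwise with `Gⱼ ∈ C¹_c`, `H ∈ C_c`, then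
`W(x) = ∑ⱼ ∫ Gⱼ(y) ∂ⱼΓ(x - y) dy + ∫ H(y) Γ(x - y) dy` (Green's representation
`W(x) = ∫ Γ(x - y) ΔW(y) dy`, Gilbarg–Trudinger (2.17), and the integration by parts
`∫ Γ(x - y) ∂ⱼGⱼ(y) dy = ∫ ∂ⱼΓ(x - y) Gⱼ(y) dy` of Lemma 4.1). [cite: GilbargTrudinger2001, (2.17) with Lemma 4.1] -/
theorem eq_sum_potential_of_laplacian_eq {W : EuclideanSpace ℝ (Fin 3) → ℝ}
    (hW : ContDiff ℝ 2 W) (hWc : HasCompactSupport W)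
    {G : Fin 3 → EuclideanSpace ℝ (Fin 3) → ℝ} (hG : ∀ j, ContDiff ℝ 1 (G j))
    (hGc : ∀ j, HasCompactSupport (G j)) {H : EuclideanSpace ℝ (Fin 3) → ℝ} (hH : Continuous H)
    (hHc : HasCompactSupport H)
    (hΔ : ∀ y, (Δ W) y = ∑ j, fderiv ℝ (G j) y (EuclideanSpace.single j (1 : ℝ)) + H y)
    (x : EuclideanSpace ℝ (Fin 3)) :
    W x = (∑ j, ∫ y, G j y * newtonKernelGrad j (x - y)) + ∫ y, H y * newtonKernel (x - y) := by
  rw [← integral_newtonKernel_mul_laplacian hW hWc x]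
  simp_rw [hΔ, mul_add, Finset.mul_sum]
  have hi1 : ∀ j, Integrable (fun y => newtonKernel (x - y) *
      fderiv ℝ (G j) y (EuclideanSpace.single j (1 : ℝ)))
      (volume : Measure (EuclideanSpace ℝ (Fin 3))) := fun j =>
    integrable_newtonKernel_mul
      (((hG j).continuous_fderiv one_ne_zero).clm_apply continuous_const)
      ((hGc j).fderiv_apply (𝕜 := ℝ) (EuclideanSpace.single j (1 : ℝ))) x
  have hi2 : Integrable (fun y => newtonKernel (x - y) * H y)
      (volume : Measure (EuclideanSpace ℝ (Fin 3))) := integrable_newtonKernel_mul hH hHc x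
  rw [integral_add (integrable_finsetSum _ fun j _ => hi1 j) hi2,
    integral_finsetSum _ fun j _ => hi1 j]
  congr 1
  · refine Finset.sum_congr rfl fun j _ => ?_
    have h := integral_newtonKernel_smul_fderiv_eq (F := ℝ) (hG j) (hGc j) x
      (EuclideanSpace.single j (1 : ℝ))
    simp only [smul_eq_mul] at h
    rw [h]
    refine integral_congr_ae (Eventually.of_forall fun y => ?_)
    show fderiv ℝ newtonKernel (x - y) (EuclideanSpace.single j (1 : ℝ)) * G j y =
      G j y * newtonKernelGrad j (x - y)
    rw [newtonKernelGrad_eq_fderiv_newtonKernel]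
    ring
  · refine integral_congr_ae (Eventually.of_forall fun y => ?_)
    ring

end NewtonPotentialRepresentation

end Literature.Analysis.FluidPDE
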